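import Literature.AlgebraicGeometry.Resolution.SharpOrderCoordinateSubspace
import Mathlib.Algebra.MvPolynomial.Equiv
import HarnessLib

/-!
# The `J♯` order criterion along a coordinate CENTRE of positive dimension (restriction of scalars and
# transport of `Diff^{≤ n}` under algebra isomorphisms)

Topic: `Literature/AlgebraicGeometry/Resolution`. Sequel of `SharpOrderCoordinateSubspace.lean`, whose criterion
`le_idealOfVars_pow_iff_sharp_le_sup` is stated at the ORIGIN (`𝔪 = (x_j)_j`) of `K[x_σ]` over a domain `K`. Since that
file allows any domain of coefficients, the origin of `R[x_τ]` for `R = K[x_υ]` is the generic point of the coordinate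
subspace `D = V(x_τ) ≅ 𝔸^υ` of `𝔸^{τ ⊔ υ}_K` — a CENTRE of positive dimension — provided the differential operators
may be taken `K`-linear (all of `Diff_{K[x]/K}`, not only the `R`-linear ones). This file supplies the two transport
facts that make this work and draws the conclusion:

* `IsDiffOpLE.restrictScalars`, `diffIdeal_le_diffIdeal_restrictScalars`, `sharp_le_sharp_restrictScalars` — along a
  tower `K → R → A`, an `R`-linear differential operator of order `≤ n` is a `K`-linear one of order `≤ n` (the
  commutators are the same maps), so `Diff^{≤ n}_{A/R}(J) ⊆ Diff^{≤ n}_{A/K}(J)` and `J♯_{A/R} ⊆ J♯_{A/K}`;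
* **`le_idealOfVars_pow_iff_sharpK_le_sup`** — for `A = R[x_τ]`, `R` a DOMAIN and a `K`-algebra, `S ⊆ τ`:
  **`J ⊆ 𝔪_R^b ⇔ J♯_{A/K} ⊆ 𝔪_R^{b!} + (x_i : i ∈ S)`**, `𝔪_R = (x_j)_{j ∈ τ}` — «`D ⊂ Sing(J, b) ⇔ D ⊂ Sing(J♯ 𝒪_W, b!)`»
  for the centre `D = V(x_τ)` inside `W = V(x_S)` (`⇒`: `sharp_le_pow_of_le_pow` over `K`; `⇐`: the `R`-criterion of the
  previous file applied to the smaller `J♯_{A/R}`);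
* `IsDiffOpLE.algEquivConj`, `diffIdeal_map_algEquiv`, `sharp_map_algEquiv` — `Diff^{≤ n}` and `J♯` are transported by
  `K`-algebra isomorphisms (conjugation `e ∘ D ∘ e⁻¹`; EGA IV₄ 16.8.8: the commutator recursion is intrinsic);
* **`le_span_pow_iff_sharp_le_sup_sum`** — the same criterion written in ONE polynomial ring `K[x_{τ ⊔ υ}]` over a domain
  `K`: with `P = (x_{inl i})_{i ∈ τ}` the prime ideal of the coordinate centre `D = V(x_τ)` (of dimension `|υ|`) and
  `S ⊆ τ`: `J ⊆ P^b ⇔ J♯ ⊆ P^{b!} + (x_{inl i} : i ∈ S)` (via Mathlib's `MvPolynomial.sumAlgEquiv`).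

Interpretation (the pointwise, stage-0 content of the restriction property [BGV12, Prop. 6.9] at the generic point of
a centre; Hironaka's formula `J♯`, Th. 3.10 of the 2017 manuscript, cited for the formula only): for the marked ideal
`(J, b)` on `Z = 𝔸^{τ ⊔ υ}_K`, a coordinate subspace `W = V(x_S)` and a coordinate centre `D = V(x_τ) ⊆ W`, «`D` is
permissible for `(J, b)`» (`J ⊆ P_D^b`; for this prime generated by variables the ordinary power is the symbolic one) iff
«`D` is permissible for `(J♯ 𝒪_W, b!)`». NOT here: non-coordinate centres, blow-ups.

## References
* [BravoGarciaEscamillaVillamayor2012] A. Bravo, M. L. García-Escamilla, O. E. Villamayor U., arXiv:1107.1797 = Indiana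
  Univ. Math. J. 61 (2012), Prop. 6.9 (restriction property, `X ⊂ V` smooth of any codimension).
* [EGAIV4] ÉGA IV₄ Déf. 16.8.1, Prop. 16.8.8 (b) (commutator recursion), Prop. 16.8.9.
* [Hironaka2017] H. Hironaka, ms. 2017, Th. 3.10 p.10 (the formula `J♯`; unrefereed — formula only).
-/

open MvPolynomial

namespace Literature.AlgebraicGeometry.Resolution

/-! ### Restriction of scalars along a tower `K → R → A` -/

section Tower

variable (K : Type*) {R A : Type*} [CommSemiring K] [CommSemiring R] [CommRing A] [Algebra K R] [Algebra K A]
  [Algebra R A] [IsScalarTower K R A]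

/-- The commutator with a multiplication does not see the scalars: `[D|_K, a] = [D, a]|_K`.
[cite: EGAIV4, Prop. 16.8.8 (16.8.8.1) (the operators D_a are defined ring-theoretically)] -/
theorem commMul_restrictScalars (D : A →ₗ[R] A) (a : A) :
    commMul K (D.restrictScalars K) a = (commMul R D a).restrictScalars K :=
  LinearMap.ext fun _ => rfl

variable {K} in
/-- **An `R`-linear differential operator of order `≤ n` is a `K`-linear one of order `≤ n`** (`K → R → A` a tower).
[cite: EGAIV4, Prop. 16.8.8 (b) (the order is defined by the commutator recursion, independent of the base once linearity is granted)] -/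
theorem IsDiffOpLE.restrictScalars :
    ∀ {n : ℕ} {D : A →ₗ[R] A}, IsDiffOpLE R n D → IsDiffOpLE K n (D.restrictScalars K)
  | 0, D, h => fun a => by
    rw [commMul_restrictScalars, h a, LinearMap.restrictScalars_zero]
  | _ + 1, D, h => fun a => by
    rw [commMul_restrictScalars]
    exact (h a).restrictScalars

/-- Hence `Diff^{≤ n}_{A/R}(J) ⊆ Diff^{≤ n}_{A/K}(J)`. [cite: EGAIV4, Déf. 16.8.1 / Prop. 16.8.8 (b)] -/
theorem diffIdeal_le_diffIdeal_restrictScalars (n : ℕ) (J : Ideal A) : diffIdeal R n J ≤ diffIdeal K n J :=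
  (diffIdeal_le_iff R).2 fun D hD _ hf => apply_mem_diffIdeal K (D := D.restrictScalars K) hD.restrictScalars hf

/-- … and `J♯_{A/R} ⊆ J♯_{A/K}` for `J♯ = Σ_{j<b} (Diff^{≤ j} J)^{b!/(b−j)}`.
[cite: BravoGarciaEscamillaVillamayor2012, Prop. 6.9 (the differential Rees algebra grows with the class of operators)] -/
theorem sharp_le_sharp_restrictScalars (J : Ideal A) (b : ℕ) :
    ∑ j ∈ Finset.range b, diffIdeal R j J ^ (b.factorial / (b - j)) ≤
      ∑ j ∈ Finset.range b, diffIdeal K j J ^ (b.factorial / (b - j)) := by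
  rw [Ideal.sum_eq_sup, Ideal.sum_eq_sup]
  exact Finset.sup_mono_fun fun j _ => Ideal.pow_right_mono (diffIdeal_le_diffIdeal_restrictScalars K j J) _

end Tower

/-! ### The criterion at the generic point of a coordinate centre: coefficients in a domain `R ⊇ K` -/

section Centre

variable {τ : Type*} (K : Type*) {R : Type*} [CommRing K] [CommRing R] [IsDomain R] [Algebra K R]

/-- **The `J♯` order criterion along a coordinate centre of positive dimension.** Let `R` be a domain and a
`K`-algebra (think `R = K[x_υ]`, the coordinate ring of the centre), `A = R[x_τ]`, `𝔪_R = (x_j)_{j ∈ τ}` (the prime ideal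
of the centre `D = V(x_τ) ≅ Spec R`), `S ⊆ τ` (`W = V(x_S) ⊇ D`), `J ⊆ A`, `b ∈ ℕ`, and `J♯ = Σ_{j<b}
(Diff^{≤ j}_{A/K} J)^{b!/(b−j)}` with ALL `K`-linear differential operators. Then
**`J ⊆ 𝔪_R^b ⇔ J♯ ⊆ 𝔪_R^{b!} + (x_i : i ∈ S)`** — «`D ⊂ Sing(J, b) ⇔ D ⊂ Sing(J♯ 𝒪_W, b!)`».
[cite: BravoGarciaEscamillaVillamayor2012, Prop. 6.9 (restriction property; pointwise form at the generic point of a coordinate centre)] -/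
theorem le_idealOfVars_pow_iff_sharpK_le_sup (S : Set τ) (J : Ideal (MvPolynomial τ R)) (b : ℕ) :
    J ≤ idealOfVars τ R ^ b ↔
      ∑ j ∈ Finset.range b, diffIdeal K j J ^ (b.factorial / (b - j)) ≤
        idealOfVars τ R ^ b.factorial ⊔ Ideal.span (X '' S) :=
  ⟨fun h => (sharp_le_pow_of_le_pow K h).trans le_sup_left,
    fun h => (le_idealOfVars_pow_iff_sharp_le_sup S J b).2 ((sharp_le_sharp_restrictScalars K J b).trans h)⟩

end Centre

/-! ### Transport of `Diff^{≤ n}` and `J♯` under `K`-algebra isomorphisms -/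

section AlgEquiv

variable {K A B : Type*} [CommSemiring K] [CommRing A] [CommRing B] [Algebra K A] [Algebra K B] (e : A ≃ₐ[K] B)

/-- Conjugation of the commutator: `[e D e⁻¹, b] = e [D, e⁻¹ b] e⁻¹`. [cite: EGAIV4, Prop. 16.8.8 (16.8.8.1)] -/
theorem commMul_algEquivConj (D : A →ₗ[K] A) (b : B) :
    commMul K (e.toLinearMap ∘ₗ D ∘ₗ e.symm.toLinearMap) b =
      e.toLinearMap ∘ₗ commMul K D (e.symm b) ∘ₗ e.symm.toLinearMap := by
  refine LinearMap.ext fun t => ?_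
  simp only [commMul_apply, LinearMap.coe_comp, Function.comp_apply, AlgEquiv.toLinearMap_apply, map_mul,
    map_sub, AlgEquiv.apply_symm_apply]

/-- **`Diff^{≤ n}` is intrinsic**: the conjugate `e ∘ D ∘ e⁻¹` of an operator of order `≤ n` by a `K`-algebra
isomorphism has order `≤ n`. [cite: EGAIV4, Prop. 16.8.8 (b)] -/
theorem IsDiffOpLE.algEquivConj :
    ∀ {n : ℕ} {D : A →ₗ[K] A}, IsDiffOpLE K n D → IsDiffOpLE K n (e.toLinearMap ∘ₗ D ∘ₗ e.symm.toLinearMap)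
  | 0, D, h => fun b => by
    rw [commMul_algEquivConj, h (e.symm b), LinearMap.zero_comp, LinearMap.comp_zero]
  | _ + 1, D, h => fun b => by
    rw [commMul_algEquivConj]
    exact (h (e.symm b)).algEquivConj

/-- For ideals of a ring and a ring isomorphism: `I ⊆ I'` iff `e(I) ⊆ e(I')`. [folklore] -/
private theorem map_le_map_iff_of_algEquiv {I I' : Ideal A} : I.map e ≤ I'.map e ↔ I ≤ I' := by
  refine ⟨fun h x hx => ?_, fun h => Ideal.map_mono h⟩
  have hx' : e x ∈ I'.map e := h (Ideal.mem_map_of_mem e hx)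
  obtain ⟨y, hy, hyx⟩ := (Ideal.mem_map_of_equiv e (e x)).1 hx'
  rwa [← e.injective hyx]

/-- **`e(Diff^{≤ n}(J)) = Diff^{≤ n}(e(J))`** for a `K`-algebra isomorphism `e`. [cite: EGAIV4, Déf. 16.8.1 / Prop. 16.8.8 (b) (functoriality of Diff^n under isomorphisms)] -/
theorem diffIdeal_map_algEquiv (n : ℕ) (J : Ideal A) : (diffIdeal K n J).map e = diffIdeal K n (J.map e) := by
  apply le_antisymm
  · rw [Ideal.map_le_iff_le_comap, diffIdeal_le_iff]
    intro D hD f hf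
    rw [Ideal.mem_comap]
    have h := apply_mem_diffIdeal K (hD.algEquivConj e) (Ideal.mem_map_of_mem e hf)
    simpa only [LinearMap.coe_comp, Function.comp_apply, AlgEquiv.toLinearMap_apply, AlgEquiv.symm_apply_apply]
      using h
  · rw [diffIdeal_le_iff]
    intro D' hD' g hg
    obtain ⟨f, hf, rfl⟩ := (Ideal.mem_map_of_equiv e g).1 hg
    have h := apply_mem_diffIdeal K (hD'.algEquivConj e.symm) hf
    have hmem := Ideal.mem_map_of_mem e h
    simpa only [LinearMap.coe_comp, Function.comp_apply, AlgEquiv.toLinearMap_apply, AlgEquiv.symm_symm,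
      AlgEquiv.apply_symm_apply] using hmem

/-- `Ideal.map` of a finite sum of ideals. [folklore] -/
private theorem map_finset_sum {ι : Type*} (s : Finset ι) (I : ι → Ideal A) :
    (∑ i ∈ s, I i).map e = ∑ i ∈ s, (I i).map e := by
  classical
  induction s using Finset.induction_on with
  | empty => simp [Ideal.map_bot]
  | insert i s hi ih => rw [Finset.sum_insert hi, Finset.sum_insert hi, Ideal.add_eq_sup, Ideal.add_eq_sup,
      Ideal.map_sup, ih]

/-- **`e(J♯) = (e J)♯`** for a `K`-algebra isomorphism `e`.
[cite: BravoGarciaEscamillaVillamayor2012, Prop. 6.9 (the differential Rees algebra is intrinsic)] -/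
theorem sharp_map_algEquiv (J : Ideal A) (b : ℕ) :
    (∑ j ∈ Finset.range b, diffIdeal K j J ^ (b.factorial / (b - j))).map e =
      ∑ j ∈ Finset.range b, diffIdeal K j (J.map e) ^ (b.factorial / (b - j)) := by
  rw [map_finset_sum]
  refine Finset.sum_congr rfl fun j _ => ?_
  rw [Ideal.map_pow, diffIdeal_map_algEquiv]

end AlgEquiv

/-! ### The criterion in one polynomial ring `K[x_{τ ⊔ υ}]`: the prime of the coordinate centre `V(x_τ)` -/

section Sum

variable {τ υ : Type*} (K : Type*) [CommRing K] [IsDomain K]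

omit [IsDomain K] in
/-- Under `K[x_{τ ⊔ υ}] ≅ (K[x_υ])[x_τ]` the prime `(x_{inl i})_{i ∈ τ}` of the centre `V(x_τ)` goes to the origin ideal
`(x_i)_{i ∈ τ}` of `(K[x_υ])[x_τ]`. [folklore] -/
private theorem map_sumAlgEquiv_span_inl :
    (Ideal.span (X '' Set.range (Sum.inl : τ → τ ⊕ υ)) : Ideal (MvPolynomial (τ ⊕ υ) K)).map
        (sumAlgEquiv K τ υ) = idealOfVars τ (MvPolynomial υ K) := by
  rw [Ideal.map_span, ← Set.image_comp, ← Set.range_comp]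
  change Ideal.span (Set.range fun i => sumAlgEquiv K τ υ (X (Sum.inl i))) = _
  simp only [sumAlgEquiv_X_inl]

omit [IsDomain K] in
/-- … and the ideal `(x_{inl i})_{i ∈ S}` of `W = V(x_S)`, `S ⊆ τ`, goes to `(x_i)_{i ∈ S}`. [folklore] -/
private theorem map_sumAlgEquiv_span_inl_image (S : Set τ) :
    (Ideal.span (X '' (Sum.inl '' S)) : Ideal (MvPolynomial (τ ⊕ υ) K)).map (sumAlgEquiv K τ υ) =
      Ideal.span (X '' S) := by
  rw [Ideal.map_span, ← Set.image_comp, ← Set.image_comp]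
  refine congrArg Ideal.span (Set.image_congr' fun i => ?_)
  simp only [Function.comp_apply, sumAlgEquiv_X_inl]

/-- **The `J♯` order criterion for a coordinate centre of positive dimension, in `K[x_{τ ⊔ υ}]`** (`K` a domain): let
`P = (x_{inl i})_{i ∈ τ}` be the prime ideal of the centre `D = V(x_τ) ≅ 𝔸^υ`, `S ⊆ τ` (`W = V(x_S) ⊇ D`), `J` an ideal,
`b ∈ ℕ`, `J♯ = Σ_{j<b} (Diff^{≤ j}_{K[x]/K} J)^{b!/(b−j)}`. Then **`J ⊆ P^b ⇔ J♯ ⊆ P^{b!} + (x_{inl i} : i ∈ S)`** —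
«`D ⊂ Sing(J, b) ⇔ D ⊂ Sing(J♯ 𝒪_W, b!)`», i.e. the one-step LSB with centre `D` is permissible for `(J, b)` iff it is
for `(J♯ 𝒪_W, b!)`. [cite: BravoGarciaEscamillaVillamayor2012, Prop. 6.9 (restriction property; pointwise form at the generic point of a coordinate centre)] -/
theorem le_span_pow_iff_sharp_le_sup_sum (S : Set τ) (J : Ideal (MvPolynomial (τ ⊕ υ) K)) (b : ℕ) :
    J ≤ Ideal.span (X '' Set.range (Sum.inl : τ → τ ⊕ υ)) ^ b ↔
      ∑ j ∈ Finset.range b, diffIdeal K j J ^ (b.factorial / (b - j)) ≤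
        Ideal.span (X '' Set.range (Sum.inl : τ → τ ⊕ υ)) ^ b.factorial ⊔ Ideal.span (X '' (Sum.inl '' S)) := by
  set e := sumAlgEquiv K τ υ with he
  rw [← map_le_map_iff_of_algEquiv e, ← map_le_map_iff_of_algEquiv e (I := ∑ j ∈ Finset.range b, _),
    Ideal.map_pow, Ideal.map_sup, Ideal.map_pow, sharp_map_algEquiv, map_sumAlgEquiv_span_inl,
    map_sumAlgEquiv_span_inl_image]
  exact le_idealOfVars_pow_iff_sharpK_le_sup K S (J.map e) b

end Sum

end Literature.AlgebraicGeometry.Resolution
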